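import Mathlib
import Literature.Computability.AlgebraicComplexity.PrattTrapezoidVal
import Summits.MatrixMultiplication.MatrixMultiplication.Theorems.EisensteinValCertificatesPrimeValSavingPointwiseLoads
import Summits.MatrixMultiplication.MatrixMultiplication.Theorems.EisensteinValCertificatesPrimeValSavingDisjointSquares
import Summits.MatrixMultiplication.MatrixMultiplication.Theorems.EisensteinValCertificatesPrimeValSavingValConstant

/-!
# Def. 3.2 as three dichotomies, and min-load pruning

Fourth support file of the series `…PointwiseLoads` / `…DisjointSquares` / `…ValConstant` for route
`MatrixMultiplication/EisensteinValCertificates` (cruxes `stmt-MatrixMultiplication-7788` `PrimeValSaving`,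
stmt-7790 `PrimeFourThirdsSaving`).  Notation as there (points `a + b + c = 0`, `A`-, `B`-, `C`-lines,
loads).

* **Dichotomy form of Def. 3.2.**  System 1 says exactly: two distinct `C`-lines cannot share both an
  `A`-line and a `B`-line (`C_dichotomy`); systems 2, 3 likewise for `B`-lines and `A`-lines
  (`B_dichotomy`, `A_dichotomy`).  Conversely the three dichotomies imply trapezoid-freeness
  (`of_dichotomy`), so `iff_dichotomy` is a drop-in characterisation that avoids the `card (filter …) ≤ 1`
  phrasing — convenient both for constructions (LOW side) and for proofs (UP side); in shift form:
  `z, z + x ∈ -C`, `x ≠ 0` ⇒ `z ∉ (A + (B ∩ (B - x))) ∩ (B + (A ∩ (A - x)))`.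
* **Min-load pruning** (`exists_pruned`): for thresholds `tA, tB, tC` every triple contains a sub-triple
  in which every remaining `A`-line has load `≥ tA`, every `B`-line `≥ tB`, every `C`-line `≥ tC`, and
  at most `tA·#(A \ A') + tB·#(B \ B') + tC·#(C \ C')` points were lost.  (No trapezoid-freeness
  needed; with `of_subset` the pruned triple is again trapezoid-free.)  Also the `B`-fibred count
  `card_zeroSumTriples_eq_sum_B`.

[cite: Pratt2024, Def. 3.2, Prop. 3.1]
-/

-- single-conjunct summit: the mandated namespace repeats `MatrixMultiplication`.
set_option linter.dupNamespace false

namespace Summit.MatrixMultiplication.MatrixMultiplication.Theorems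

namespace PrattValDichotomy

open Finset Literature.Computability.AlgebraicComplexity PrattValPointwiseLoads PrattValDisjointSquares
  PrattValConstant

variable {G : Type*} [AddCommGroup G] [DecidableEq G] {A B C : Finset G}

/-! ### The three dichotomies -/

/-- **System 1 as a dichotomy**: two distinct `C`-lines `c₁ ≠ c₂` either share no `A`-line or share
no `B`-line. [cite: Pratt2024, Def. 3.2] -/
theorem C_dichotomy (h : IsEquilateralTrapezoidFree A B C) {c₁ c₂ : G} (hc₁ : c₁ ∈ C)
    (hc₂ : c₂ ∈ C) (hne : c₁ ≠ c₂) :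
    (∀ a ∈ A, -(a + c₁) ∈ B → -(a + c₂) ∉ B) ∨ (∀ b ∈ B, -(b + c₁) ∈ A → -(b + c₂) ∉ A) := by
  by_contra hcon
  rw [not_or] at hcon
  obtain ⟨h1, h2⟩ := hcon
  push Not at h1 h2
  obtain ⟨a, ha, ha₁, ha₂⟩ := h1
  obtain ⟨b, hb, hb₁, hb₂⟩ := h2
  exact hne (sys₁_eq h ha hb hb₁ ha₁ hc₁ hb₂ ha₂ hc₂ (by abel) (by abel) (by abel) (by abel)).2.2

/-- **System 2 as a dichotomy**: two distinct `B`-lines `b₁ ≠ b₂` either share no `A`-line or share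
no `C`-line. [cite: Pratt2024, Def. 3.2] -/
theorem B_dichotomy (h : IsEquilateralTrapezoidFree A B C) {b₁ b₂ : G} (hb₁ : b₁ ∈ B)
    (hb₂ : b₂ ∈ B) (hne : b₁ ≠ b₂) :
    (∀ a ∈ A, -(a + b₁) ∈ C → -(a + b₂) ∉ C) ∨ (∀ c ∈ C, -(b₁ + c) ∈ A → -(b₂ + c) ∉ A) := by
  by_contra hcon
  rw [not_or] at hcon
  obtain ⟨h1, h2⟩ := hcon
  push Not at h1 h2
  obtain ⟨a, ha, ha₁, ha₂⟩ := h1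
  obtain ⟨c, hc, hc₁, hc₂⟩ := h2
  exact hne (sys₂_eq h ha hc hc₁ hb₁ ha₁ hc₂ hb₂ ha₂ (by abel) (by abel) (by abel) (by abel)).2.1

/-- **System 3 as a dichotomy**: two distinct `A`-lines `a₁ ≠ a₂` either share no `B`-line or share
no `C`-line. [cite: Pratt2024, Def. 3.2] -/
theorem A_dichotomy (h : IsEquilateralTrapezoidFree A B C) {a₁ a₂ : G} (ha₁ : a₁ ∈ A)
    (ha₂ : a₂ ∈ A) (hne : a₁ ≠ a₂) :
    (∀ b ∈ B, -(a₁ + b) ∈ C → -(a₂ + b) ∉ C) ∨ (∀ c ∈ C, -(a₁ + c) ∈ B → -(a₂ + c) ∉ B) := by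
  by_contra hcon
  rw [not_or] at hcon
  obtain ⟨h1, h2⟩ := hcon
  push Not at h1 h2
  obtain ⟨b, hb, hb₁, hb₂⟩ := h1
  obtain ⟨c, hc, hc₁, hc₂⟩ := h2
  exact hne (sys₃_eq h hb hc ha₁ hc₁ hb₁ ha₂ hc₂ hb₂ (by abel) (by abel) (by abel) (by abel)).1

/-- **Converse**: the three dichotomies imply equilateral trapezoid-freeness.
[cite: Pratt2024, Def. 3.2] -/
theorem of_dichotomy
    (hC : ∀ c₁ ∈ C, ∀ c₂ ∈ C, c₁ ≠ c₂ →
      (∀ a ∈ A, -(a + c₁) ∈ B → -(a + c₂) ∉ B) ∨ (∀ b ∈ B, -(b + c₁) ∈ A → -(b + c₂) ∉ A))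
    (hB : ∀ b₁ ∈ B, ∀ b₂ ∈ B, b₁ ≠ b₂ →
      (∀ a ∈ A, -(a + b₁) ∈ C → -(a + b₂) ∉ C) ∨ (∀ c ∈ C, -(b₁ + c) ∈ A → -(b₂ + c) ∉ A))
    (hA : ∀ a₁ ∈ A, ∀ a₂ ∈ A, a₁ ≠ a₂ →
      (∀ b ∈ B, -(a₁ + b) ∈ C → -(a₂ + b) ∉ C) ∨ (∀ c ∈ C, -(a₁ + c) ∈ B → -(a₂ + c) ∉ B)) :
    IsEquilateralTrapezoidFree A B C := by
  -- helper: from `u + v + w = 0` get `w = -(u + v)` etc.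
  have e3 : ∀ {u v w : G}, u + v + w = 0 → w = -(u + v) := fun h => by
    rw [← sub_eq_zero]; rw [← h]; abel
  have e2 : ∀ {u v w : G}, u + v + w = 0 → v = -(u + w) := fun h => by
    rw [← sub_eq_zero]; rw [← h]; abel
  have e1 : ∀ {u v w : G}, u + v + w = 0 → u = -(v + w) := fun h => by
    rw [← sub_eq_zero]; rw [← h]; abel
  refine ⟨fun a' ha' b' hb' => ?_, fun a' ha' c' hc' => ?_, fun b' hb' c' hc' => ?_⟩
  · -- system 1: solutions are determined by `c`; two distinct `c` share the A-line a' and B-line b'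
    refine Finset.card_le_one.2 fun t ht t' ht' => ?_
    simp only [mem_filter, mem_product] at ht ht'
    obtain ⟨⟨hta, htb, htc⟩, et, ft⟩ := ht
    obtain ⟨⟨hta', htb', htc'⟩, et', ft'⟩ := ht'
    have hb_eq : t.2.1 = -(a' + t.2.2) := e2 et
    have ha_eq : t.1 = -(b' + t.2.2) := by rw [e1 ft]
    have hb_eq' : t'.2.1 = -(a' + t'.2.2) := e2 et'
    have ha_eq' : t'.1 = -(b' + t'.2.2) := by rw [e1 ft']
    by_cases hc : t.2.2 = t'.2.2
    · refine Prod.ext ?_ (Prod.ext ?_ hc)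
      · rw [ha_eq, ha_eq', hc]
      · rw [hb_eq, hb_eq', hc]
    · exfalso
      rcases hC _ htc _ htc' hc with h1 | h1
      · refine h1 a' ha' (hb_eq ▸ htb) ?_
        exact hb_eq' ▸ htb'
      · refine h1 b' hb' (ha_eq ▸ hta) ?_
        exact ha_eq' ▸ hta'
  · -- system 2: solutions determined by `b`
    refine Finset.card_le_one.2 fun t ht t' ht' => ?_
    simp only [mem_filter, mem_product] at ht ht'
    obtain ⟨⟨hta, htb, htc⟩, et, ft⟩ := ht
    obtain ⟨⟨hta', htb', htc'⟩, et', ft'⟩ := ht'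
    have hc_eq : t.2.2 = -(a' + t.2.1) := e3 et
    have ha_eq : t.1 = -(t.2.1 + c') := e1 ft
    have hc_eq' : t'.2.2 = -(a' + t'.2.1) := e3 et'
    have ha_eq' : t'.1 = -(t'.2.1 + c') := e1 ft'
    by_cases hb : t.2.1 = t'.2.1
    · refine Prod.ext ?_ (Prod.ext hb ?_)
      · rw [ha_eq, ha_eq', hb]
      · rw [hc_eq, hc_eq', hb]
    · exfalso
      rcases hB _ htb _ htb' hb with h1 | h1
      · exact h1 a' ha' (hc_eq ▸ htc) (hc_eq' ▸ htc')
      · exact h1 c' hc' (ha_eq ▸ hta) (ha_eq' ▸ hta')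
  · -- system 3: solutions determined by `a`
    refine Finset.card_le_one.2 fun t ht t' ht' => ?_
    simp only [mem_filter, mem_product] at ht ht'
    obtain ⟨⟨hta, htb, htc⟩, et, ft⟩ := ht
    obtain ⟨⟨hta', htb', htc'⟩, et', ft'⟩ := ht'
    have hc_eq : t.2.2 = -(t.1 + b') := e3 et
    have hb_eq : t.2.1 = -(t.1 + c') := e2 ft
    have hc_eq' : t'.2.2 = -(t'.1 + b') := e3 et'
    have hb_eq' : t'.2.1 = -(t'.1 + c') := e2 ft'
    by_cases ha : t.1 = t'.1
    · refine Prod.ext ha (Prod.ext ?_ ?_)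
      · rw [hb_eq, hb_eq', ha]
      · rw [hc_eq, hc_eq', ha]
    · exfalso
      rcases hA _ hta _ hta' ha with h1 | h1
      · exact h1 b' hb' (hc_eq ▸ htc) (hc_eq' ▸ htc')
      · exact h1 c' hc' (hb_eq ▸ htb) (hb_eq' ▸ htb')

/-- **Def. 3.2 ⇔ the three dichotomies.** [cite: Pratt2024, Def. 3.2] -/
theorem iff_dichotomy :
    IsEquilateralTrapezoidFree A B C ↔
      (∀ c₁ ∈ C, ∀ c₂ ∈ C, c₁ ≠ c₂ →
        (∀ a ∈ A, -(a + c₁) ∈ B → -(a + c₂) ∉ B) ∨ (∀ b ∈ B, -(b + c₁) ∈ A → -(b + c₂) ∉ A)) ∧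
      (∀ b₁ ∈ B, ∀ b₂ ∈ B, b₁ ≠ b₂ →
        (∀ a ∈ A, -(a + b₁) ∈ C → -(a + b₂) ∉ C) ∨ (∀ c ∈ C, -(b₁ + c) ∈ A → -(b₂ + c) ∉ A)) ∧
      (∀ a₁ ∈ A, ∀ a₂ ∈ A, a₁ ≠ a₂ →
        (∀ b ∈ B, -(a₁ + b) ∈ C → -(a₂ + b) ∉ C) ∨ (∀ c ∈ C, -(a₁ + c) ∈ B → -(a₂ + c) ∉ B)) :=
  ⟨fun h => ⟨fun _ hc₁ _ hc₂ hne => C_dichotomy h hc₁ hc₂ hne,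
    fun _ hb₁ _ hb₂ hne => B_dichotomy h hb₁ hb₂ hne,
    fun _ ha₁ _ ha₂ hne => A_dichotomy h ha₁ ha₂ hne⟩,
    fun h => of_dichotomy h.1 h.2.1 h.2.2⟩

/-! ### The `B`-fibred count -/

/-- The number of solutions is the total load of the `B`-lines:
`#(zeroSumTriples A B C) = ∑_{b ∈ B} #{a ∈ A : -(a+b) ∈ C}`. [folklore] -/
theorem card_zeroSumTriples_eq_sum_B (A B C : Finset G) :
    #(zeroSumTriples A B C) = ∑ b ∈ B, #(A.filter fun a => -(a + b) ∈ C) := by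
  rw [← card_zeroSumTriples_rotate, ← card_zeroSumTriples_rotate, card_zeroSumTriples_eq_sum_C]
  refine sum_congr rfl fun b _ => ?_
  rw [card_A_through_C_eq]

/-! ### Min-load pruning -/

/-- Removing one `A`-line removes exactly its load. [folklore] -/
theorem card_zeroSumTriples_erase_A (A B C : Finset G) {a : G} (ha : a ∈ A) :
    #(zeroSumTriples A B C) =
      #(zeroSumTriples (A.erase a) B C) + #(B.filter fun b => -(a + b) ∈ C) := by
  rw [card_zeroSumTriples_eq_sum_A, card_zeroSumTriples_eq_sum_A, ← sum_erase_add _ _ ha]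

/-- Removing one `B`-line removes exactly its load. [folklore] -/
theorem card_zeroSumTriples_erase_B (A B C : Finset G) {b : G} (hb : b ∈ B) :
    #(zeroSumTriples A B C) =
      #(zeroSumTriples A (B.erase b) C) + #(A.filter fun a => -(a + b) ∈ C) := by
  rw [card_zeroSumTriples_eq_sum_B, card_zeroSumTriples_eq_sum_B, ← sum_erase_add _ _ hb]

/-- Removing one `C`-line removes exactly its load. [folklore] -/
theorem card_zeroSumTriples_erase_C (A B C : Finset G) {c : G} (hc : c ∈ C) :
    #(zeroSumTriples A B C) =
      #(zeroSumTriples A B (C.erase c)) + #(A.filter fun a => -(a + c) ∈ B) := by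
  rw [card_zeroSumTriples_eq_sum_C, card_zeroSumTriples_eq_sum_C, ← sum_erase_add _ _ hc]

/-- **Min-load pruning.** For any thresholds `tA, tB, tC`, every triple `(A, B, C)` contains a
sub-triple `(A', B', C')` in which every `A`-line has load `≥ tA`, every `B`-line `≥ tB` and every
`C`-line `≥ tC` (loads computed in the sub-triple), obtained by deleting lines one at a time, so that
`T(A,B,C) ≤ T(A',B',C') + tA·#(A \ A') + tB·#(B \ B') + tC·#(C \ C')`.  (Typical use:
`tA = T/(6#A)` etc. keeps half of the points; the pruned triple is trapezoid-free by `of_subset`.)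
[folklore] -/
theorem exists_pruned (A B C : Finset G) (tA tB tC : ℕ) :
    ∃ A' ⊆ A, ∃ B' ⊆ B, ∃ C' ⊆ C,
      #(zeroSumTriples A B C) ≤ #(zeroSumTriples A' B' C') +
        tA * #(A \ A') + tB * #(B \ B') + tC * #(C \ C') ∧
      (∀ a ∈ A', tA ≤ #(B'.filter fun b => -(a + b) ∈ C')) ∧
      (∀ b ∈ B', tB ≤ #(A'.filter fun a => -(a + b) ∈ C')) ∧
      (∀ c ∈ C', tC ≤ #(A'.filter fun a => -(a + c) ∈ B')) := by
  -- induction on the total number of lines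
  suffices H : ∀ n : ℕ, ∀ A B C : Finset G, #A + #B + #C = n →
      ∃ A' ⊆ A, ∃ B' ⊆ B, ∃ C' ⊆ C,
        #(zeroSumTriples A B C) ≤ #(zeroSumTriples A' B' C') +
          tA * #(A \ A') + tB * #(B \ B') + tC * #(C \ C') ∧
        (∀ a ∈ A', tA ≤ #(B'.filter fun b => -(a + b) ∈ C')) ∧
        (∀ b ∈ B', tB ≤ #(A'.filter fun a => -(a + b) ∈ C')) ∧
        (∀ c ∈ C', tC ≤ #(A'.filter fun a => -(a + c) ∈ B')) from H _ A B C rfl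
  intro n
  induction n using Nat.strong_induction_on with
  | _ n ih =>
    intro A B C hn
    by_cases hgood : (∀ a ∈ A, tA ≤ #(B.filter fun b => -(a + b) ∈ C)) ∧
        (∀ b ∈ B, tB ≤ #(A.filter fun a => -(a + b) ∈ C)) ∧
        (∀ c ∈ C, tC ≤ #(A.filter fun a => -(a + c) ∈ B))
    · exact ⟨A, Subset.rfl, B, Subset.rfl, C, Subset.rfl, by simp, hgood.1, hgood.2.1, hgood.2.2⟩
    · rw [not_and_or, not_and_or] at hgood
      rcases hgood with hbad | hbad | hbad
      · -- a deficient `A`-line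
        push Not at hbad
        obtain ⟨a, ha, hlt⟩ := hbad
        have hlt' : #(A.erase a) + #B + #C < n := by
          rw [← hn, card_erase_of_mem ha]
          have := card_pos.2 ⟨a, ha⟩
          omega
        obtain ⟨A', hA', B', hB', C', hC', hT, h1, h2, h3⟩ := ih _ hlt' (A.erase a) B C rfl
        refine ⟨A', hA'.trans (erase_subset _ _), B', hB', C', hC', ?_, h1, h2, h3⟩
        have hdiff : #(A \ A') = #(A.erase a \ A') + 1 := by
          have : A \ A' = insert a (A.erase a \ A') := by
            ext x
            simp only [mem_sdiff, mem_insert, mem_erase]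
            constructor
            · rintro ⟨hx, hx'⟩
              by_cases hxa : x = a
              · exact Or.inl hxa
              · exact Or.inr ⟨⟨hxa, hx⟩, hx'⟩
            · rintro (hxa | ⟨⟨_, hx⟩, hx'⟩)
              · rw [hxa]; exact ⟨ha, fun h => (notMem_erase a A) (hA' h)⟩
              · exact ⟨hx, hx'⟩
          rw [this, card_insert_of_notMem]
          simp
        rw [card_zeroSumTriples_erase_A A B C ha, hdiff]
        nlinarith [hT, hlt]
      · -- a deficient `B`-line
        push Not at hbad
        obtain ⟨b, hb, hlt⟩ := hbad
        have hlt' : #A + #(B.erase b) + #C < n := by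
          rw [← hn, card_erase_of_mem hb]
          have := card_pos.2 ⟨b, hb⟩
          omega
        obtain ⟨A', hA', B', hB', C', hC', hT, h1, h2, h3⟩ := ih _ hlt' A (B.erase b) C rfl
        refine ⟨A', hA', B', hB'.trans (erase_subset _ _), C', hC', ?_, h1, h2, h3⟩
        have hdiff : #(B \ B') = #(B.erase b \ B') + 1 := by
          have : B \ B' = insert b (B.erase b \ B') := by
            ext x
            simp only [mem_sdiff, mem_insert, mem_erase]
            constructor
            · rintro ⟨hx, hx'⟩
              by_cases hxb : x = b
              · exact Or.inl hxb
              · exact Or.inr ⟨⟨hxb, hx⟩, hx'⟩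
            · rintro (hxb | ⟨⟨_, hx⟩, hx'⟩)
              · rw [hxb]; exact ⟨hb, fun h => (notMem_erase b B) (hB' h)⟩
              · exact ⟨hx, hx'⟩
          rw [this, card_insert_of_notMem]
          simp
        rw [card_zeroSumTriples_erase_B A B C hb, hdiff]
        nlinarith [hT, hlt]
      · -- a deficient `C`-line
        push Not at hbad
        obtain ⟨c, hc, hlt⟩ := hbad
        have hlt' : #A + #B + #(C.erase c) < n := by
          rw [← hn, card_erase_of_mem hc]
          have := card_pos.2 ⟨c, hc⟩
          omega
        obtain ⟨A', hA', B', hB', C', hC', hT, h1, h2, h3⟩ := ih _ hlt' A B (C.erase c) rfl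
        refine ⟨A', hA', B', hB', C', hC'.trans (erase_subset _ _), ?_, h1, h2, h3⟩
        have hdiff : #(C \ C') = #(C.erase c \ C') + 1 := by
          have : C \ C' = insert c (C.erase c \ C') := by
            ext x
            simp only [mem_sdiff, mem_insert, mem_erase]
            constructor
            · rintro ⟨hx, hx'⟩
              by_cases hxc : x = c
              · exact Or.inl hxc
              · exact Or.inr ⟨⟨hxc, hx⟩, hx'⟩
            · rintro (hxc | ⟨⟨_, hx⟩, hx'⟩)
              · rw [hxc]; exact ⟨hc, fun h => (notMem_erase c C) (hC' h)⟩
              · exact ⟨hx, hx'⟩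
          rw [this, card_insert_of_notMem]
          simp
        rw [card_zeroSumTriples_erase_C A B C hc, hdiff]
        nlinarith [hT, hlt]

end PrattValDichotomy

end Summit.MatrixMultiplication.MatrixMultiplication.Theorems
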